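import Literature.NumberTheory.EllipticCurves.CuspFormTwistModularSymbol
import Literature.NumberTheory.EllipticCurves.PAdicLFunctionDistributionHoldsProofs
import Literature.NumberTheory.EllipticCurves.ModularFormsGamma0Genus
import HarnessLib

/-!
# The rational plus symbol of a quadratic twist: `[r]⁺_{f_χ} = c · ∑_{u mod m} χ(u) [r + u/m]⁺_f` with ONE constant `c`
# (Mazur–Tate–Teitelbaum 1986, §I.8; Shimura 1971, Prop. 3.64)

Sequel of `CuspFormTwistModularSymbol` (the complex identity `{∞, r}_{f_χ} = g(χ)⁻¹ ∑_u χ(u){∞, r + u/m}_f`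
at every cusp). For RATIONAL NEWFORMS `f` and `F = f_χ = charTwist L hN hm hχ f` (both `IsNewform0` with
coefficient field `ℚ`, as for the newforms of an elliptic curve and of its quadratic twist) and an EVEN
primitive quadratic `χ`, the tree's `Ω⁺`-normalised rational symbols (`ratPlusSymbol`, MTT §I.8
`[r]⁺ = re plusSymbol(r)/Ω⁺`, `ratCast_ratPlusSymbol_holds`) satisfy

* `ratPlusSymbol_charTwist_mul_plusPeriod_mul_gaussSum`:
  `[r]⁺_F · Ω⁺_F · g(χ) = Ω⁺_f · ∑_u χ(u) [r + u/m]⁺_f` in `ℂ`, for every `r ∈ ℚ`;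
* `exists_rat_forall_ratPlusSymbol_charTwist_eq`: hence there is ONE rational constant `c` with
  `[r]⁺_F = c · ∑_u χ(u) [r + u/m]⁺_f` for all `r` (the character written through an integer-valued
  function `ε` with `χ = ε`, e.g. the Legendre symbol), and `c · Ω⁺_F · g(χ) = Ω⁺_f` as soon as one twisted
  sum is non-zero (so `c = Ω⁺_f / (g(χ) Ω⁺_F)`, the period ratio of MTT §I.8 / Pal 2012).

This is the form in which modular-symbol data (Kurihara numbers, Mazur–Tate elements, mod-`p`
level-lowering identities) pass from `f` to its twist with a single scalar. Everything is proved; no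
named fact, no definition.

## References

* B. Mazur, J. Tate, J. Teitelbaum, Invent. Math. 84 (1986), §I.8. [MazurTateTeitelbaum1986Invent]
* G. Shimura, *Introduction to the arithmetic theory of automorphic functions* (1971), Prop. 3.64. [Shimura1971]
* J. E. Cremona, *Algorithms for modular elliptic curves* (1997), §2.8. [CremonaAlgorithms1997]
-/

noncomputable section

open scoped MatrixGroups ModularForm Real

open CongruenceSubgroup UpperHalfPlane Complex

namespace Literature.NumberTheory.EllipticCurves.ModularForms

section RatTwist

variable {N : ℕ} [NeZero N]

/-- **`[r]⁺_f · Ω⁺_f = plusSymbol f r`** (as complex numbers) for a rational newform: the tree's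
`ratCast_ratPlusSymbol_holds` (`[r]⁺ = re plusSymbol/Ω⁺`), `Ω⁺_f > 0` (`IsNewform0.plusPeriod_pos_holds`)
and the reality of `plusSymbol f r` for real coefficients (`plusSymbol_eq_re_of`).
[cite: MazurTateTeitelbaum1986Invent, §I.8] -/
theorem ratCast_ratPlusSymbol_mul_plusPeriod (f : CuspForm (Gamma0 N) 2) (hf : IsNewform0 f)
    (hQ : coeffField f = ⊥) (r : ℚ) :
    ((ratPlusSymbol f r : ℚ) : ℂ) * (plusPeriod f : ℂ) = plusSymbol f r := by
  have hΩ : 0 < plusPeriod f := IsNewform0.plusPeriod_pos_holds hf hQ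
  have hreal := plusSymbol_eq_re_of f (modularSymbol_neg_eq_conj_holds f)
    (cuspCoeff_im_eq_zero_of_coeffField_eq_bot hQ) r
  have hcast : ((ratPlusSymbol f r : ℚ) : ℝ) = (plusSymbol f r).re / plusPeriod f := by
    rw [ratCast_ratPlusSymbol_holds hf hQ r, normalizedPlusSymbol]
  have hC : ((ratPlusSymbol f r : ℚ) : ℂ) = ((((ratPlusSymbol f r : ℚ) : ℝ)) : ℂ) := by norm_cast
  rw [hC, hcast, hreal, Complex.ofReal_re, Complex.ofReal_div, div_mul_cancel₀]
  exact_mod_cast hΩ.ne'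

variable {m : ℕ} [NeZero m] (L : ℕ) [NeZero L]

/-- **The rational plus symbol of the twist, EVEN primitive quadratic `χ`**:
`[r]⁺_{f_χ} · Ω⁺_{f_χ} · g(χ) = Ω⁺_f · ∑_{u mod m} χ(u) [r + u/m]⁺_f` in `ℂ`, for rational newforms
`f` and `f_χ = charTwist L hN hm hχ f` (MTT 1986 §I.8; Shimura 1971 Prop. 3.64 at the symbol level,
`plusSymbol_charTwist_of_even`). [cite: MazurTateTeitelbaum1986Invent, §I.8] [cite: Shimura1971, Prop. 3.64] -/
theorem ratPlusSymbol_charTwist_mul_plusPeriod_mul_gaussSum (hN : N ∣ L) (hm : m ^ 2 ∣ L)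
    {χ : DirichletCharacter ℂ m} (hχ : χ.IsQuadratic) (hχe : χ.Even) (hχp : χ.IsPrimitive)
    {f : CuspForm (Gamma0 N) 2} (hf : IsNewform0 f) (hQ : coeffField f = ⊥)
    (hF : IsNewform0 (charTwist L hN hm hχ f)) (hQF : coeffField (charTwist L hN hm hχ f) = ⊥)
    (r : ℚ) :
    ((ratPlusSymbol (charTwist L hN hm hχ f) r : ℚ) : ℂ) * (plusPeriod (charTwist L hN hm hχ f) : ℂ) *
        gaussSum χ (ZMod.stdAddChar (N := m)) =
      (plusPeriod f : ℂ) * ∑ u : ZMod m, χ u * ((ratPlusSymbol f (r + twistShift u) : ℚ) : ℂ) := by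
  have hg : gaussSum χ (ZMod.stdAddChar (N := m)) ≠ 0 := gaussSum_stdAddChar_ne_zero_of_isPrimitive hχp
  rw [ratCast_ratPlusSymbol_mul_plusPeriod _ hF hQF, plusSymbol_charTwist_of_even L hN hm hχ hχe f r]
  have hterm : ∀ u : ZMod m, (plusPeriod f : ℂ) * (χ u * ((ratPlusSymbol f (r + twistShift u) : ℚ) : ℂ)) =
      χ u * plusSymbol f (r + twistShift u) := fun u ↦ by
    rw [← ratCast_ratPlusSymbol_mul_plusPeriod f hf hQ]
    ring
  have hR : (plusPeriod f : ℂ) * ∑ u : ZMod m, χ u * ((ratPlusSymbol f (r + twistShift u) : ℚ) : ℂ) =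
      ∑ u : ZMod m, χ u * plusSymbol f (r + twistShift u) := by
    rw [Finset.mul_sum]
    exact Finset.sum_congr rfl fun u _ ↦ hterm u
  rw [hR, mul_comm, ← mul_assoc, mul_inv_cancel₀ hg, one_mul]

/-- **ONE rational constant**: for rational newforms `f`, `f_χ` and an even primitive quadratic `χ`
written through an integer-valued function `ε` (`χ(u) = ε(u)`, e.g. the Legendre symbol mod a prime
`m ≡ 1 (mod 4)`), there is `c ∈ ℚ` with `[r]⁺_{f_χ} = c · ∑_{u mod m} ε(u) [r + u/m]⁺_f` for EVERY
`r ∈ ℚ`; and `c · Ω⁺_{f_χ} · g(χ) = Ω⁺_f` as soon as one twisted sum is non-zero (`c = Ω⁺_f/(g(χ) Ω⁺_{f_χ})`;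
if all twisted sums vanish then all `[r]⁺_{f_χ}` vanish and `c` is immaterial).
[cite: MazurTateTeitelbaum1986Invent, §I.8] [cite: Shimura1971, Prop. 3.64] -/
theorem exists_rat_forall_ratPlusSymbol_charTwist_eq (hN : N ∣ L) (hm : m ^ 2 ∣ L)
    {χ : DirichletCharacter ℂ m} (hχ : χ.IsQuadratic) (hχe : χ.Even) (hχp : χ.IsPrimitive)
    {f : CuspForm (Gamma0 N) 2} (hf : IsNewform0 f) (hQ : coeffField f = ⊥)
    (hF : IsNewform0 (charTwist L hN hm hχ f)) (hQF : coeffField (charTwist L hN hm hχ f) = ⊥)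
    (ε : ZMod m → ℤ) (hε : ∀ u, χ u = (ε u : ℂ)) :
    ∃ c : ℚ, (∀ r : ℚ, ratPlusSymbol (charTwist L hN hm hχ f) r =
        c * ∑ u : ZMod m, (ε u : ℚ) * ratPlusSymbol f (r + twistShift u)) ∧
      ((∃ r : ℚ, ∑ u : ZMod m, (ε u : ℚ) * ratPlusSymbol f (r + twistShift u) ≠ 0) →
        (c : ℂ) * (plusPeriod (charTwist L hN hm hχ f) : ℂ) * gaussSum χ (ZMod.stdAddChar (N := m)) =
          (plusPeriod f : ℂ)) := by
  set F := charTwist L hN hm hχ f with hFdef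
  set S : ℚ → ℚ := fun r ↦ ∑ u : ZMod m, (ε u : ℚ) * ratPlusSymbol f (r + twistShift u) with hSdef
  have hg : gaussSum χ (ZMod.stdAddChar (N := m)) ≠ 0 := gaussSum_stdAddChar_ne_zero_of_isPrimitive hχp
  have hΩF : (plusPeriod F : ℂ) ≠ 0 := by exact_mod_cast (IsNewform0.plusPeriod_pos_holds hF hQF).ne'
  -- the complex identity, with the twisted sum recognised as the cast of `S r`
  have key : ∀ r : ℚ, ((ratPlusSymbol F r : ℚ) : ℂ) * (plusPeriod F : ℂ) *
      gaussSum χ (ZMod.stdAddChar (N := m)) = (plusPeriod f : ℂ) * ((S r : ℚ) : ℂ) := by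
    intro r
    rw [ratPlusSymbol_charTwist_mul_plusPeriod_mul_gaussSum L hN hm hχ hχe hχp hf hQ hF hQF r, hSdef]
    push_cast
    congr 1
    exact Finset.sum_congr rfl fun u _ ↦ by rw [hε u]
  by_cases hex : ∃ r₀ : ℚ, S r₀ ≠ 0
  · obtain ⟨r₀, hr₀⟩ := hex
    refine ⟨ratPlusSymbol F r₀ / S r₀, fun r ↦ ?_, fun _ ↦ ?_⟩
    · -- compare the identities at `r` and `r₀`
      have h1 := key r
      have h0 := key r₀
      have hS0 : ((S r₀ : ℚ) : ℂ) ≠ 0 := by exact_mod_cast hr₀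
      have hK : (plusPeriod F : ℂ) * gaussSum χ (ZMod.stdAddChar (N := m)) ≠ 0 := mul_ne_zero hΩF hg
      have hC : ((ratPlusSymbol F r : ℚ) : ℂ) =
          ((ratPlusSymbol F r₀ : ℚ) : ℂ) / ((S r₀ : ℚ) : ℂ) * ((S r : ℚ) : ℂ) := by
        apply mul_right_cancel₀ hK
        rw [div_mul_eq_mul_div, div_mul_eq_mul_div, eq_div_iff hS0]
        linear_combination (((S r₀ : ℚ) : ℂ)) * h1 - (((S r : ℚ) : ℂ)) * h0
      change ratPlusSymbol F r = ratPlusSymbol F r₀ / S r₀ * S r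
      exact_mod_cast hC
    · have h0 := key r₀
      have hS0 : ((S r₀ : ℚ) : ℂ) ≠ 0 := by exact_mod_cast hr₀
      push_cast
      rw [div_mul_eq_mul_div, div_mul_eq_mul_div, div_eq_iff hS0]
      linear_combination h0
  · simp only [not_exists, not_not] at hex
    refine ⟨0, fun r ↦ ?_, fun ⟨r₀, hr₀⟩ ↦ absurd (hex r₀) hr₀⟩
    have h1 := key r
    rw [hex r, Rat.cast_zero, mul_zero] at h1
    have : ((ratPlusSymbol F r : ℚ) : ℂ) = 0 := by
      rcases mul_eq_zero.mp h1 with h | h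
      · rcases mul_eq_zero.mp h with h' | h'
        · exact h'
        · exact absurd h' hΩF
      · exact absurd h hg
    have hz : ratPlusSymbol F r = 0 := by exact_mod_cast this
    rw [hz, zero_mul]

end RatTwist

end Literature.NumberTheory.EllipticCurves.ModularForms

end
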